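import Mathlib
import HarnessLib
import Summits.Ventures.LatticeQCDFlow.Exactness.NCMCGeneralSpaceOverlap

/-!
# NCMCGeneralSpaceDroppedWeightsBias — the "weights dropped" (X-3 / INVALID-3) control on a general
# state space: the UNWEIGHTED mean of an observable over forward records estimates `E_{P_F} f`, and
# `|E_{P_R} f − E_{P_F} f| ≤ σ_{P_F}(f) · √(1/ESS_F − 1)` — a planted-invalid arm that forgets the
# Jarzynski weights is INVISIBLE on observables when `ESS_F ≈ 1`; detection must live on the weight
# bookkeeping

HONEST FRAMING: exact (Metropolis-corrected) sampling algorithms for lattice gauge theory;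
figures of merit are autocorrelation/cost numbers at stated couplings and volumes; no
continuum-physics claim.

Venture `LatticeQCDFlow` (cell pub-lqcd); FANOUT row 19 (`su2-snf`, GEN-8 — the row's acceptance
test includes "INVALID-3 control run once": an arm whose reweighting is switched off must be scored
INVALID by the frozen scorers; CARD §3(c)).  OUR WORK (Cauchy–Schwarz over row 13's
`Exactness/NCMCGeneralSpace*` framework); nothing is cited as a fact.  For a Crooks pair
(`P_F = fwdPathLaw ν₀ κF`, `P_R = fwdPathLaw ν₁ κR`, `dP_R/dP_F = ρ = e^{ΔF − W}`,
`Exactness/NCMCGeneralSpaceRelativeEntropy.revPathLaw_eq_withDensity`) and an observable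
`f ∈ L²(P_F)` of the record: the honest estimator targets `E_{P_R} f = E_{P_F}[f ρ]`, the
weights-dropped estimator targets `E_{P_F} f`, and their difference is a covariance,
`E_{P_R} f − E_{P_F} f = Cov_{P_F}(f, ρ)`, bounded by `σ_{P_F}(f)·σ_{P_F}(ρ)` with
`σ²_{P_F}(ρ) = E_{P_F}[ρ²] − 1 = 1/ESS_F − 1` (`ESS_F = (E_F e^{−W})²/E_F e^{−2W} = 1/E_F[e^{−2(W−ΔF)}]`,
row 13's `essPop_eq_inv_dissipation`).

* `integral_rev_eq_integral_fwd_mul` — `E_{P_R} f = E_{P_F}[f · e^{ΔF − W}]` for `f·ρ ∈ L¹(P_F)`;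
* `integral_fwd_exp_sub_work_sq` — `E_{P_F}[e^{2(ΔF − W)}] = 1/ESS_F` (`E_{P_F}[e^{ΔF − W}] = 1` is
  row 13's `CrooksPair.integral_density_eq_one`, `Exactness/NCMCGeneralSpaceOverlap`, imported);
* `integral_rev_sub_integral_fwd_eq_covariance` — `E_{P_R} f − E_{P_F} f = Cov_{P_F}(e^{ΔF − W}, f)`
  (Mathlib `covariance`);
* **`abs_integral_rev_sub_integral_fwd_le`** — `f, e^{−W} ∈ L²(P_F)`:
  `|E_{P_R} f − E_{P_F} f| ≤ √Var_{P_F}(f) · √(1/ESS_F − 1)`.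

* `integral_rev_exp_sub_work_sub` — sharpness: for `f = e^{ΔF − W}` the difference IS `1/ESS_F − 1`.

Reading (value-free, the P6 item of the row's write-up): at the production `n_step` of a
well-tuned NE-MCMC arm `ESS_F` is `O(1)` below `1`, so the observable-level bias of the X-3 arm is at
most `σ(f)·√(1/ESS_F − 1)` — of the order of the arm's own statistical error unless `N·(1/ESS_F − 1)`
is large; an observable `z`-test cannot be the detector of record, the weight / work bookkeeping
(`log w = −W + const`, `Var(log w) = Var(W)`) is.  NOT CLAIMED: any number of ours; the finite-sample (estimator-level) version of the bias.
-/

namespace Summit.Ventures.LatticeQCDFlow.Exactness.GeneralNCMC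

open MeasureTheory ProbabilityTheory Set Filter
open scoped ENNReal

variable {Ω E : Type*} [MeasurableSpace Ω] [MeasurableSpace E]

namespace CrooksPair

variable {ν₀ ν₁ : Measure Ω} {κF κR : Kernel Ω E} {s e : E → Ω} {W : E → ℝ}

/-- **`E_{P_R} f = E_{P_F}[f · e^{ΔF − W}]`** — the honest (reweighted) target in forward-record
terms (change of measure along `dP_R/dP_F = e^{ΔF − W}`; no integrability hypothesis: both sides are
Bochner integrals of the same function against `P_F.withDensity`). -/
theorem integral_rev_eq_integral_fwd_mul [IsFiniteMeasure ν₀] [IsFiniteMeasure ν₁]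
    [IsMarkovKernel κF] [IsMarkovKernel κR] (h0 : ν₀ univ ≠ 0) (h1 : ν₁ univ ≠ 0)
    (h : CrooksPair ν₀ ν₁ κF κR s e W) {ΔF : ℝ}
    (hΔF : Real.exp (-ΔF) = ((ν₀ univ)⁻¹ * ν₁ univ).toReal) (f : E → ℝ) :
    ∫ ε, f ε ∂(fwdPathLaw ν₁ κR) = ∫ ε, Real.exp (ΔF - W ε) * f ε ∂(fwdPathLaw ν₀ κF) := by
  have hW := h.measurable_W
  have hm : Measurable fun ε => Real.exp (ΔF - W ε) := by fun_prop
  rw [h.revPathLaw_eq_withDensity h0 h1 hΔF,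
    integral_withDensity_eq_integral_toReal_smul₀ hm.ennreal_ofReal.aemeasurable
      (Eventually.of_forall fun _ => ENNReal.ofReal_lt_top)]
  refine integral_congr_ae (Eventually.of_forall fun ε => ?_)
  simp only
  rw [ENNReal.toReal_ofReal (Real.exp_pos _).le, smul_eq_mul]

/-- **`E_{P_F}[e^{2(ΔF − W)}] = 1/ESS_F`**, `ESS_F = (E_F e^{−W})²/E_F e^{−2W}` the population Kish ESS
of the forward weights (row 13's `essPop_eq_inv_dissipation`, rearranged). -/
theorem integral_fwd_exp_sub_work_sq [IsFiniteMeasure ν₀] [IsFiniteMeasure ν₁] [IsMarkovKernel κR]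
    (h0 : ν₀ univ ≠ 0) (h1 : ν₁ univ ≠ 0) (h : CrooksPair ν₀ ν₁ κF κR s e W) {ΔF : ℝ}
    (hΔF : Real.exp (-ΔF) = ((ν₀ univ)⁻¹ * ν₁ univ).toReal) :
    ∫ ε, Real.exp (ΔF - W ε) ^ 2 ∂(fwdPathLaw ν₀ κF)
      = 1 / ((∫ ε, Real.exp (-W ε) ∂(fwdPathLaw ν₀ κF)) ^ 2
          / ∫ ε, Real.exp (-(2 * W ε)) ∂(fwdPathLaw ν₀ κF)) := by
  rw [h.essPop_eq_inv_dissipation h0 h1 hΔF, one_div_one_div]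
  refine integral_congr_ae (Eventually.of_forall fun ε => ?_)
  simp only
  rw [sq, ← Real.exp_add]; congr 1; ring

/-- **THE WEIGHTS-DROPPED BIAS IS A COVARIANCE, BOUNDED BY `σ(f)·√(1/ESS_F − 1)`.**  For a Crooks pair
with `e^{−W} ∈ L²(P_F)` (i.e. `ESS_F > 0`) and an observable `f ∈ L²(P_F)`:
`|E_{P_R} f − E_{P_F} f| ≤ √(Var_{P_F} f) · √(1/ESS_F − 1)` — the planted-invalid arm that averages
`f` WITHOUT the Jarzynski weights is off target by at most the observable's own standard deviation
times `√(1/ESS_F − 1)`. -/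
theorem abs_integral_rev_sub_integral_fwd_le [IsFiniteMeasure ν₀] [IsFiniteMeasure ν₁]
    [IsMarkovKernel κF] [IsMarkovKernel κR] (h0 : ν₀ univ ≠ 0) (h1 : ν₁ univ ≠ 0)
    (h : CrooksPair ν₀ ν₁ κF κR s e W) {ΔF : ℝ}
    (hΔF : Real.exp (-ΔF) = ((ν₀ univ)⁻¹ * ν₁ univ).toReal)
    (hw2 : MemLp (fun ε => Real.exp (-W ε)) 2 (fwdPathLaw ν₀ κF))
    {f : E → ℝ} (hf2 : MemLp f 2 (fwdPathLaw ν₀ κF)) :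
    |∫ ε, f ε ∂(fwdPathLaw ν₁ κR) - ∫ ε, f ε ∂(fwdPathLaw ν₀ κF)|
      ≤ Real.sqrt (Var[f; fwdPathLaw ν₀ κF]) *
          Real.sqrt (1 / ((∫ ε, Real.exp (-W ε) ∂(fwdPathLaw ν₀ κF)) ^ 2
            / ∫ ε, Real.exp (-(2 * W ε)) ∂(fwdPathLaw ν₀ κF)) - 1) := by
  haveI := isProbabilityMeasure_fwdPathLaw ν₀ h0 κF
  set P := fwdPathLaw ν₀ κF with hP
  set ρ : E → ℝ := fun ε => Real.exp (ΔF - W ε) with hρ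
  set m : ℝ := ∫ ε, f ε ∂P with hm
  set ESS : ℝ := (∫ ε, Real.exp (-W ε) ∂P) ^ 2 / ∫ ε, Real.exp (-(2 * W ε)) ∂P with hESS
  have hW := h.measurable_W
  have hρm : Measurable ρ := by fun_prop
  -- `ρ ∈ L²(P_F)`: `ρ = e^{ΔF} · e^{−W}`
  have hρ2 : MemLp ρ 2 P := by
    have h2 := hw2.const_mul (Real.exp ΔF)
    refine (memLp_congr_ae (Eventually.of_forall fun ε => ?_)).1 h2
    simp only [hρ]
    rw [sub_eq_add_neg, Real.exp_add]
  have hfm : AEStronglyMeasurable f P := hf2.aestronglyMeasurable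
  have hfi : Integrable f P := hf2.integrable one_le_two
  have hρi : Integrable ρ P := hρ2.integrable one_le_two
  have hρfi : Integrable (fun ε => ρ ε * f ε) P := hρ2.integrable_mul hf2
  -- the two moments of `ρ`
  have hρ1 : ∫ ε, ρ ε ∂P = 1 := h.integral_density_eq_one hΔF
  have hρsq : ∫ ε, ρ ε ^ 2 ∂P = 1 / ESS := h.integral_fwd_exp_sub_work_sq h0 h1 hΔF
  -- the bias is the covariance `∫ (ρ − 1)(f − m) dP`
  have hcen2 : MemLp (fun ε => f ε - m) 2 P := hf2.sub (memLp_const m)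
  have hρc2 : MemLp (fun ε => ρ ε - 1) 2 P := hρ2.sub (memLp_const 1)
  have hprod : Integrable (fun ε => (ρ ε - 1) * (f ε - m)) P := hρc2.integrable_mul hcen2
  have hrev : ∫ ε, f ε ∂(fwdPathLaw ν₁ κR) = ∫ ε, ρ ε * f ε ∂P :=
    h.integral_rev_eq_integral_fwd_mul h0 h1 hΔF f
  have hbias : ∫ ε, f ε ∂(fwdPathLaw ν₁ κR) - m = ∫ ε, (ρ ε - 1) * (f ε - m) ∂P := by
    have hexp : ∀ ε, (ρ ε - 1) * (f ε - m) = ρ ε * f ε - m * ρ ε - f ε + m := fun ε => by ring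
    have i2 : Integrable (fun ε => m * ρ ε) P := hρi.const_mul m
    have i3 : Integrable (fun ε => ρ ε * f ε - m * ρ ε) P := hρfi.sub i2
    have i4 : Integrable (fun ε => ρ ε * f ε - m * ρ ε - f ε) P := i3.sub hfi
    have hR : ∫ ε, (ρ ε - 1) * (f ε - m) ∂P
        = (∫ ε, ρ ε * f ε ∂P) - m * (∫ ε, ρ ε ∂P) - (∫ ε, f ε ∂P) + m := by
      simp_rw [hexp]
      rw [integral_add i4 (integrable_const m), integral_sub i3 hfi, integral_sub hρfi i2,
        integral_const_mul, integral_const, probReal_univ, one_smul]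
    rw [hR, hrev, hρ1, ← hm]
    ring
  -- Cauchy–Schwarz on `|ρ − 1| · |f − m|`
  have hcs : ∫ ε, |f ε - m| * |ρ ε - 1| ∂P
      ≤ Real.sqrt (∫ ε, (f ε - m) ^ 2 ∂P) * Real.sqrt (∫ ε, (ρ ε - 1) ^ 2 ∂P) := by
    have h1' : MemLp (fun ε => |f ε - m|) (ENNReal.ofReal 2) P := by
      rw [show ENNReal.ofReal 2 = 2 by simp]; exact hcen2.abs
    have h2' : MemLp (fun ε => |ρ ε - 1|) (ENNReal.ofReal 2) P := by
      rw [show ENNReal.ofReal 2 = 2 by simp]; exact hρc2.abs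
    have hH := integral_mul_le_Lp_mul_Lq_of_nonneg (μ := P) Real.HolderConjugate.two_two
      (f := fun ε => |f ε - m|) (g := fun ε => |ρ ε - 1|)
      (ae_of_all _ (fun _ => abs_nonneg _)) (ae_of_all _ (fun _ => abs_nonneg _)) h1' h2'
    have ha : ∀ ε, |f ε - m| ^ (2 : ℝ) = (f ε - m) ^ 2 := fun ε => by rw [Real.rpow_two, sq_abs]
    have hb : ∀ ε, |ρ ε - 1| ^ (2 : ℝ) = (ρ ε - 1) ^ 2 := fun ε => by rw [Real.rpow_two, sq_abs]
    simp only [ha, hb] at hH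
    rw [Real.sqrt_eq_rpow, Real.sqrt_eq_rpow]
    exact hH
  -- the two `L²` norms: `Var f` and `1/ESS − 1`
  have hvar : ∫ ε, (f ε - m) ^ 2 ∂P = Var[f; P] := by
    rw [variance_eq_integral hfm.aemeasurable]
  have hρvar : ∫ ε, (ρ ε - 1) ^ 2 ∂P = 1 / ESS - 1 := by
    have hexp : ∀ ε, (ρ ε - 1) ^ 2 = ρ ε ^ 2 - 2 * ρ ε + 1 := fun ε => by ring
    simp_rw [hexp]
    have hρ2i : Integrable (fun ε => ρ ε ^ 2) P := hρ2.integrable_sq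
    have j2 : Integrable (fun ε => 2 * ρ ε) P := hρi.const_mul 2
    have j3 : Integrable (fun ε => ρ ε ^ 2 - 2 * ρ ε) P := hρ2i.sub j2
    rw [integral_add j3 (integrable_const _), integral_sub hρ2i j2, integral_const_mul, hρsq, hρ1,
      integral_const, probReal_univ, one_smul]
    ring
  calc |∫ ε, f ε ∂(fwdPathLaw ν₁ κR) - m|
      = |∫ ε, (ρ ε - 1) * (f ε - m) ∂P| := by rw [hbias]
    _ ≤ ∫ ε, |(ρ ε - 1) * (f ε - m)| ∂P := abs_integral_le_integral_abs
    _ = ∫ ε, |f ε - m| * |ρ ε - 1| ∂P :=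
        integral_congr_ae (Eventually.of_forall fun ε => by simp only; rw [abs_mul, mul_comm])
    _ ≤ Real.sqrt (∫ ε, (f ε - m) ^ 2 ∂P) * Real.sqrt (∫ ε, (ρ ε - 1) ^ 2 ∂P) := hcs
    _ = Real.sqrt (Var[f; P]) * Real.sqrt (1 / ESS - 1) := by rw [hvar, hρvar]

/-- **THE WEIGHTS-DROPPED BIAS IS THE COVARIANCE OF THE OBSERVABLE WITH THE WEIGHT**:
`E_{P_R} f − E_{P_F} f = Cov_{P_F}(e^{ΔF − W}, f)` (`e^{−W}, f ∈ L²(P_F)`). -/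
theorem integral_rev_sub_integral_fwd_eq_covariance [IsFiniteMeasure ν₀] [IsFiniteMeasure ν₁]
    [IsMarkovKernel κF] [IsMarkovKernel κR] (h0 : ν₀ univ ≠ 0) (h1 : ν₁ univ ≠ 0)
    (h : CrooksPair ν₀ ν₁ κF κR s e W) {ΔF : ℝ}
    (hΔF : Real.exp (-ΔF) = ((ν₀ univ)⁻¹ * ν₁ univ).toReal)
    (hw2 : MemLp (fun ε => Real.exp (-W ε)) 2 (fwdPathLaw ν₀ κF))
    {f : E → ℝ} (hf2 : MemLp f 2 (fwdPathLaw ν₀ κF)) :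
    ∫ ε, f ε ∂(fwdPathLaw ν₁ κR) - ∫ ε, f ε ∂(fwdPathLaw ν₀ κF)
      = cov[fun ε => Real.exp (ΔF - W ε), f; fwdPathLaw ν₀ κF] := by
  haveI := isProbabilityMeasure_fwdPathLaw ν₀ h0 κF
  set P := fwdPathLaw ν₀ κF with hP
  set ρ : E → ℝ := fun ε => Real.exp (ΔF - W ε) with hρ
  set m : ℝ := ∫ ε, f ε ∂P with hm
  have hW := h.measurable_W
  have hρ2 : MemLp ρ 2 P := by
    have h2 := hw2.const_mul (Real.exp ΔF)
    refine (memLp_congr_ae (Eventually.of_forall fun ε => ?_)).1 h2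
    simp only [hρ]
    rw [sub_eq_add_neg, Real.exp_add]
  have hfi : Integrable f P := hf2.integrable one_le_two
  have hρi : Integrable ρ P := hρ2.integrable one_le_two
  have hρfi : Integrable (fun ε => ρ ε * f ε) P := hρ2.integrable_mul hf2
  have hρ1 : ∫ ε, ρ ε ∂P = 1 := h.integral_density_eq_one hΔF
  have hrev : ∫ ε, f ε ∂(fwdPathLaw ν₁ κR) = ∫ ε, ρ ε * f ε ∂P :=
    h.integral_rev_eq_integral_fwd_mul h0 h1 hΔF f
  -- `cov[ρ, f] = ∫ (ρ − E ρ)(f − E f) = ∫ (ρ − 1)(f − m)`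
  rw [covariance, hρ1]
  have hexp : ∀ ε, (ρ ε - 1) * (f ε - m) = ρ ε * f ε - m * ρ ε - f ε + m := fun ε => by ring
  have i2 : Integrable (fun ε => m * ρ ε) P := hρi.const_mul m
  have i3 : Integrable (fun ε => ρ ε * f ε - m * ρ ε) P := hρfi.sub i2
  have i4 : Integrable (fun ε => ρ ε * f ε - m * ρ ε - f ε) P := i3.sub hfi
  have hR : ∫ ε, (ρ ε - 1) * (f ε - m) ∂P
      = (∫ ε, ρ ε * f ε ∂P) - m * (∫ ε, ρ ε ∂P) - (∫ ε, f ε ∂P) + m := by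
    simp_rw [hexp]
    rw [integral_add i4 (integrable_const m), integral_sub i3 hfi, integral_sub hρfi i2,
      integral_const_mul, integral_const, probReal_univ, one_smul]
  show ∫ ε, f ε ∂(fwdPathLaw ν₁ κR) - m = ∫ ε, ((ρ ε - 1) * (f ε - ∫ x, f x ∂P)) ∂P
  rw [← hm, hR, hrev, hρ1, ← hm]
  ring

/-- **SHARPNESS: the weight observable itself attains the bound.**  For `f = e^{ΔF − W}`:
`E_{P_R}[e^{ΔF − W}] − E_{P_F}[e^{ΔF − W}] = 1/ESS_F − 1` (`= σ_{P_F}(f)·√(1/ESS_F − 1)` since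
`σ²_{P_F}(e^{ΔF − W}) = 1/ESS_F − 1`): the mean Jarzynski weight is the observable on which a
weights-dropped arm is maximally visible — the bookkeeping detector of CARD §3(c). -/
theorem integral_rev_exp_sub_work_sub [IsFiniteMeasure ν₀] [IsFiniteMeasure ν₁]
    [IsMarkovKernel κF] [IsMarkovKernel κR] (h0 : ν₀ univ ≠ 0) (h1 : ν₁ univ ≠ 0)
    (h : CrooksPair ν₀ ν₁ κF κR s e W) {ΔF : ℝ}
    (hΔF : Real.exp (-ΔF) = ((ν₀ univ)⁻¹ * ν₁ univ).toReal) :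
    ∫ ε, Real.exp (ΔF - W ε) ∂(fwdPathLaw ν₁ κR) - ∫ ε, Real.exp (ΔF - W ε) ∂(fwdPathLaw ν₀ κF)
      = 1 / ((∫ ε, Real.exp (-W ε) ∂(fwdPathLaw ν₀ κF)) ^ 2
          / ∫ ε, Real.exp (-(2 * W ε)) ∂(fwdPathLaw ν₀ κF)) - 1 := by
  rw [h.integral_rev_eq_integral_fwd_mul h0 h1 hΔF, h.integral_density_eq_one hΔF,
    ← h.integral_fwd_exp_sub_work_sq h0 h1 hΔF]
  congr 1
  exact integral_congr_ae (Eventually.of_forall fun ε => by simp only; rw [sq])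

end CrooksPair

end Summit.Ventures.LatticeQCDFlow.Exactness.GeneralNCMC
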